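import Literature.AlgebraicGeometry.Motives.AbelianVarietyLatticeTensor
import HarnessLib

/-!
# Coordinates for lattice tensors as module isomorphisms: `Hom(X', Y ⊗ M) ≅ M ⊗ Hom(X', Y)`, `Hom(Y ⊗ M, X') ≅ M^∨ ⊗ Hom(Y, X')`,
# `Hom(Y ⊗ M, Y' ⊗ N) ≅ M_{κ×ι}(Hom(Y, Y'))` (Mazur–Rubin–Silverberg Prop. 1.6 (i)) and
# `T_ℓ(Y ⊗_β M) ≅ M ⊗ T_ℓ(Y)` with `g` acting by `m(g) ⊗ T_ℓ β(g)` (Thm. 2.2 (iii))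

Sequel of `Motives/AbelianVarietyLatticeTensor` (notation as there: `b` a bicone over `(Y)_{i ∈ ι}` with `Σ π_i ι_i = 𝟙`, action `ρ`
with `ι_j ρ(g) π_i = m(g)_{ij} • β(g)`).  The block calculus of the prequels is packaged as honest module isomorphisms, produced as
existence statements with their defining formulas (no definition is introduced):

* §1 **`Hom(X', Y ⊗ M) ≃ₗ[ℤ] (ι → Hom(X', Y))`, `f ↦ (f ≫ π_i)_i`, inverse `v ↦ Σ_i v_i ≫ ι_i`** (`exists_linearEquiv_hom_target`);
  **`Hom(Y ⊗ M, X') ≃ₗ[ℤ] (ι → Hom(Y, X'))`, `f ↦ (ι_j ≫ f)_j`** (`exists_linearEquiv_hom_source`); and MRS Prop. 1.6 (i)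
  **`Hom(Y ⊗ M, Y' ⊗ N) ≃ₗ[ℤ] (κ → ι → Hom(Y, Y'))`, `f ↦ (ι_j ≫ f ≫ π_k)_{kj}`, inverse `F ↦ Σ_j π_j ≫ Σ_k F_{kj} ≫ ι_k`**
  (`exists_linearEquiv_hom_blocks`: "`M_{m×n}(Hom_k(V, W)) ≅ Hom_k(V^n, W^m)`"); under these the `G`-equivariant maps are described by
  the coordinate criteria of `Motives/AbelianVarietyLatticeTensorEquivariance`;
* §2 **MRS Thm. 2.2 (iii), `T_ℓ(I ⊗ V) ≅ I ⊗ T_ℓ(V)`**: there is a `ℤ_ℓ`-linear isomorphism **`e : T_ℓ(Y ⊗ M) ≃ (ι → T_ℓ Y)`,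
  `e(x)_i = T_ℓ(π_i)(x)`, `e⁻¹(v) = Σ_i T_ℓ(ι_i)(v_i)`** (`exists_linearEquiv_tateModule`, from the additivity and functoriality of
  `T_ℓ`, Mumford §19 Thm. 3), and ANY such coordinate map intertwines `T_ℓ ρ(g)` with the Kronecker action
  **`e(T_ℓ ρ(g) x)_i = Σ_j m(g)_{ij} • T_ℓ β(g) (e(x)_j)`** (`tateModule_coord_asHom_eq_sum`) — `T_ℓ(Y ⊗_β M) ≅ M ⊗ T_ℓ(Y)` as
  `ℤ_ℓ[G]`-modules with `g ↦ m(g) ⊗ T_ℓ β(g)`; in particular for `β = 1`, `e(T_ℓ ρ(g) x)_i = Σ_j m(g)_{ij} • e(x)_j` (`…_eq_sum_of_one`).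

## References

* [MazurRubinSilverberg2007] B. Mazur, K. Rubin, A. Silverberg, *Twisting commutative algebraic groups*, J. Algebra 314 (2007)
  419–438: Prop. 1.6 (i) ("the natural isomorphisms `M_{m×n}(Hom_k(V, W)) ≅ Hom_k(V^n, W^m)` induce …"), Thm. 2.2 (iii)
  (`T_ℓ(I ⊗_𝒪 V) ≅ I ⊗_𝒪 T_ℓ(V)`, `G_k`-equivariantly; "See Proposition 6(b) of [Mi]").  Held:
  `paper:doi-10-1016-j-jalgebra-2007-02-052`, PDF pp. 4, 6 read 2026-08-28.
* [Milne1972ArithmeticAV] J. S. Milne, *On the arithmetic of abelian varieties*, Invent. Math. 17 (1972), §2 Prop. 6 (b) (the Tate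
  module of `M ⊗ A`), as reported by [MazurRubinSilverberg2007].
* [JordanEtAl2018] B. W. Jordan et al., *Abelian varieties isogenous to a power of an elliptic curve*, Compos. Math. 154 (2018), §4.1,
  Thm. 4.4 (g) (`T_ℓ 𝓗𝓸𝓶_R(M, E) ≅ Hom_R(M, T_ℓ E)`).
* [SerreLinearRepresentations1977] J.-P. Serre, *Linear Representations of Finite Groups*, GTM 42 (1977): §1.5 (tensor product in
  coordinates, PDF p. 13).
* [MumfordAV1970] D. Mumford, *Abelian Varieties* (1970), §19 (p. 173: homomorphisms between products as matrices), Thm. 3 (p. 176: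
  `T_ℓ` additive and functorial).
-/

noncomputable section

open CategoryTheory CategoryTheory.Limits
open Literature.NumberTheory.DiophantineGeometry
open Literature.RepresentationTheory.FiniteGroups

universe u

namespace Literature.AlgebraicGeometry.Motives

namespace AbelianVariety

namespace LatticeTensor

variable {K : Type u} [Field K]

/-! ## §1 `Hom` into / out of / between lattice tensors in coordinates -/

section HomCoordinates

variable {Y Y' X' : AbelianVariety K} {ι κ : Type} [Fintype ι] [Fintype κ]
  (b : Bicone (fun _ : ι ↦ Y)) (c : Bicone (fun _ : κ ↦ Y'))

/-- **`Hom(X', Y ⊗ M) ≅ M ⊗ Hom(X', Y)`**: `f ↦ (f ≫ π_i)_i` is a `ℤ`-linear isomorphism `Hom(X', Y^ι) ≃ (ι → Hom(X', Y))` with inverse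
`v ↦ Σ_i v_i ≫ ι_i` (the universal property of the product; `Hom(C, 𝓗𝓸𝓶_R(M, E)) ≅ Hom_R(M, Hom(C, E))` for `M` free).
[cite: MumfordAV1970, §19 (p. 173)] [cite: JordanEtAl2018, §4.1] [cite: MazurRubinSilverberg2007, Prop. 1.6 (i)] -/
theorem exists_linearEquiv_hom_target (hb : ∑ j, b.π j ≫ b.ι j = 𝟙 b.pt) :
    ∃ Φ : (X' ⟶ b.pt) ≃ₗ[ℤ] (ι → (X' ⟶ Y)), (∀ f i, Φ f i = f ≫ b.π i) ∧ ∀ v, Φ.symm v = ∑ i, v i ≫ b.ι i := by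
  let e : (X' ⟶ b.pt) ≃+ (ι → (X' ⟶ Y)) :=
    { toFun := fun f i ↦ f ≫ b.π i
      invFun := fun v ↦ ∑ i, v i ≫ b.ι i
      left_inv := fun f ↦ (eq_sum_comp_π_comp_ι b hb f).symm
      right_inv := fun v ↦ funext fun i ↦ sum_comp_ι_comp_π b v i
      map_add' := fun f f' ↦ funext fun i ↦ Preadditive.add_comp _ _ _ _ _ _ }
  exact ⟨e.toIntLinearEquiv, fun f i ↦ rfl, fun v ↦ rfl⟩

/-- **`Hom(Y ⊗ M, X') ≅ M^∨ ⊗ Hom(Y, X')`**: `f ↦ (ι_j ≫ f)_j` is a `ℤ`-linear isomorphism `Hom(Y^ι, X') ≃ (ι → Hom(Y, X'))` with inverse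
`v ↦ Σ_j π_j ≫ v_j` (the universal property of the coproduct; `Hom(M ⊗_R E, C) ≅ Hom_R(M, Hom(E, C))`).
[cite: MumfordAV1970, §19 (p. 173)] [cite: JordanEtAl2018, §4.1 and Remark 4.1] [cite: MazurRubinSilverberg2007, Prop. 1.6 (i)] -/
theorem exists_linearEquiv_hom_source (hb : ∑ j, b.π j ≫ b.ι j = 𝟙 b.pt) :
    ∃ Φ : (b.pt ⟶ X') ≃ₗ[ℤ] (ι → (Y ⟶ X')), (∀ f j, Φ f j = b.ι j ≫ f) ∧ ∀ v, Φ.symm v = ∑ j, b.π j ≫ v j := by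
  let e : (b.pt ⟶ X') ≃+ (ι → (Y ⟶ X')) :=
    { toFun := fun f j ↦ b.ι j ≫ f
      invFun := fun v ↦ ∑ j, b.π j ≫ v j
      left_inv := fun f ↦ (eq_sum_π_comp_ι_comp b hb f).symm
      right_inv := fun v ↦ funext fun j ↦ ι_comp_sum_π_comp b v j
      map_add' := fun f f' ↦ funext fun j ↦ Preadditive.comp_add _ _ _ _ _ _ }
  exact ⟨e.toIntLinearEquiv, fun f j ↦ rfl, fun v ↦ rfl⟩

/-- **MRS Prop. 1.6 (i): `Hom(Y ⊗ M, Y' ⊗ N) ≅ M_{κ×ι}(Hom(Y, Y'))`** — `f ↦ (ι_j ≫ f ≫ π_k)_{k,j}` is a `ℤ`-linear isomorphism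
`Hom(Y^ι, Y'^κ) ≃ (κ → ι → Hom(Y, Y'))` with inverse `F ↦ Σ_j π_j ≫ Σ_k F_{kj} ≫ ι_k` ("the natural isomorphisms
`M_{m×n}(Hom_k(V, W)) ≅ Hom_k(V^n, W^m)`"; `Hom_𝒪(I, J) ⊗ Hom(V, W) = M^∨ ⊗ N ⊗ Hom(V, W)` for free lattices).
[cite: MazurRubinSilverberg2007, Prop. 1.6 (i)] [cite: MumfordAV1970, §19 (p. 173)] -/
theorem exists_linearEquiv_hom_blocks (hb : ∑ j, b.π j ≫ b.ι j = 𝟙 b.pt) (hc : ∑ k, c.π k ≫ c.ι k = 𝟙 c.pt) :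
    ∃ Φ : (b.pt ⟶ c.pt) ≃ₗ[ℤ] (κ → ι → (Y ⟶ Y')),
      (∀ f k j, Φ f k j = b.ι j ≫ f ≫ c.π k) ∧ ∀ F, Φ.symm F = ∑ j, b.π j ≫ ∑ k, F k j ≫ c.ι k := by
  let e : (b.pt ⟶ c.pt) ≃+ (κ → ι → (Y ⟶ Y')) :=
    { toFun := fun f k j ↦ b.ι j ≫ f ≫ c.π k
      invFun := fun F ↦ ∑ j, b.π j ≫ ∑ k, F k j ≫ c.ι k
      left_inv := fun f ↦ (eq_sum_matrix b c hb hc f).symm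
      right_inv := fun F ↦ funext fun k ↦ funext fun j ↦ ι_comp_matrix_comp_π b c (fun j k ↦ F k j) j k
      map_add' := fun f f' ↦ funext fun k ↦ funext fun j ↦ by
        simp only [Preadditive.add_comp, Preadditive.comp_add, Pi.add_apply] }
  exact ⟨e.toIntLinearEquiv, fun f k j ↦ rfl, fun F ↦ rfl⟩

end HomCoordinates

/-! ## §2 `T_ℓ(Y ⊗_β M) ≅ M ⊗ T_ℓ(Y)` with `g ↦ m(g) ⊗ T_ℓ β(g)` (MRS Thm. 2.2 (iii)) -/

section TateCoordinates

variable (ℓ : ℕ) [Fact ℓ.Prime] {Y : AbelianVariety K} {ι : Type} [Fintype ι] [DecidableEq ι] (b : Bicone (fun _ : ι ↦ Y))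
  {G : Type} [Group G] (m : G →* Matrix ι ι ℤ) (β : G →* End Y) (ρ : G →* End b.pt)

omit [Fintype ι] [DecidableEq ι] in
/-- `T_ℓ(π_i)(T_ℓ(ι_i) y) = y` on Tate modules (`ι_i ≫ π_i = 𝟙`). [cite: MumfordAV1970, §19 Thm. 3 (p. 176)] -/
theorem tateModuleMap_π_tateModuleMap_ι_self (i : ι) (y : Y.tateModule ℓ) :
    tateModuleMap ℓ (b.π i) (tateModuleMap ℓ (b.ι i) y) = y := by
  rw [← LinearMap.comp_apply, ← tateModuleMap_comp, bicone_ι_π_self, tateModuleMap_id, LinearMap.id_apply]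

omit [Fintype ι] [DecidableEq ι] in
/-- `T_ℓ(π_i)(T_ℓ(ι_j) y) = 0` for `j ≠ i` (`ι_j ≫ π_i = 0`). [cite: MumfordAV1970, §19 Thm. 3 (p. 176)] -/
theorem tateModuleMap_π_tateModuleMap_ι_ne {i j : ι} (h : j ≠ i) (y : Y.tateModule ℓ) :
    tateModuleMap ℓ (b.π i) (tateModuleMap ℓ (b.ι j) y) = 0 := by
  rw [← LinearMap.comp_apply, ← tateModuleMap_comp, bicone_ι_π_ne b h, tateModuleMap_zero, LinearMap.zero_apply]

omit [DecidableEq ι] in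
/-- `Σ_i T_ℓ(ι_i)(T_ℓ(π_i) x) = x` on `T_ℓ(Y ⊗ M)` (`Σ π_i ι_i = 𝟙` and additivity of `T_ℓ`). [cite: MumfordAV1970, §19 Thm. 3 (p. 176)] -/
theorem sum_tateModuleMap_ι_tateModuleMap_π (hb : ∑ j, b.π j ≫ b.ι j = 𝟙 b.pt) (x : b.pt.tateModule ℓ) :
    ∑ i, tateModuleMap ℓ (b.ι i) (tateModuleMap ℓ (b.π i) x) = x := by
  have h : ∑ i, tateModuleMap ℓ (b.π i ≫ b.ι i) = LinearMap.id := by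
    rw [← tateModuleMap_sum, hb, tateModuleMap_id]
  simpa only [tateModuleMap_comp, LinearMap.sum_apply, LinearMap.comp_apply, LinearMap.id_apply] using
    LinearMap.congr_fun h x

omit [DecidableEq ι] in
/-- **MRS Thm. 2.2 (iii): `T_ℓ(Y ⊗ M) ≅ M ⊗_ℤ T_ℓ(Y)`.**  There is a `ℤ_ℓ`-linear isomorphism **`e : T_ℓ(Y^ι) ≃ (ι → T_ℓ Y)` with
`e(x)_i = T_ℓ(π_i) x` and `e⁻¹(v) = Σ_i T_ℓ(ι_i) v_i`** — `T_ℓ` is an additive functor (Mumford §19 Thm. 3), so it carries the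
biproduct `⊕_i Y e_i` to `⊕_i T_ℓ(Y) e_i = ℤ^ι ⊗ T_ℓ Y` ("`T_ℓ(I ⊗_𝒪 V) ≅ I ⊗_𝒪 T_ℓ(V)`"; "`T_ℓ 𝓗𝓸𝓶_R(M, E) ≅ Hom_R(M, T_ℓ E)`").
[cite: MazurRubinSilverberg2007, Thm. 2.2 (iii)] [cite: JordanEtAl2018, Thm. 4.4 (g)] [cite: MumfordAV1970, §19 Thm. 3 (p. 176)] -/
theorem exists_linearEquiv_tateModule (hb : ∑ j, b.π j ≫ b.ι j = 𝟙 b.pt) :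
    ∃ e : b.pt.tateModule ℓ ≃ₗ[ℤ_[ℓ]] (ι → Y.tateModule ℓ),
      (∀ x i, e x i = tateModuleMap ℓ (b.π i) x) ∧ ∀ v, e.symm v = ∑ i, tateModuleMap ℓ (b.ι i) (v i) := by
  refine ⟨LinearEquiv.ofLinear (LinearMap.pi fun i ↦ tateModuleMap ℓ (b.π i))
      (∑ i, tateModuleMap ℓ (b.ι i) ∘ₗ LinearMap.proj i) ?_ ?_, fun x i ↦ rfl, fun v ↦ ?_⟩
  · refine LinearMap.ext fun v ↦ funext fun i ↦ ?_
    show tateModuleMap ℓ (b.π i) ((∑ j, tateModuleMap ℓ (b.ι j) ∘ₗ LinearMap.proj j) v) = v i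
    rw [LinearMap.sum_apply, map_sum, Finset.sum_eq_single i]
    · rw [LinearMap.comp_apply, LinearMap.proj_apply, tateModuleMap_π_tateModuleMap_ι_self]
    · intro j _ hji
      rw [LinearMap.comp_apply, LinearMap.proj_apply, tateModuleMap_π_tateModuleMap_ι_ne ℓ b hji]
    · intro h
      exact absurd (Finset.mem_univ i) h
  · refine LinearMap.ext fun x ↦ ?_
    show (∑ j, tateModuleMap ℓ (b.ι j) ∘ₗ LinearMap.proj j) (fun i ↦ tateModuleMap ℓ (b.π i) x) = x
    rw [LinearMap.sum_apply]
    exact sum_tateModuleMap_ι_tateModuleMap_π ℓ b hb x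
  · show (∑ j, tateModuleMap ℓ (b.ι j) ∘ₗ LinearMap.proj j) v = _
    rw [LinearMap.sum_apply]
    rfl

/-- **`T_ℓ(Y ⊗_β M) ≅ M ⊗ T_ℓ(Y)` is `ℤ_ℓ[G]`-linear for `g ↦ m(g) ⊗ T_ℓ β(g)`**: for ANY coordinate map `e` with `e(x)_i = T_ℓ(π_i) x`,
**`e(T_ℓ ρ(g) x)_i = Σ_j m(g)_{ij} • T_ℓ β(g) (e(x)_j)`** — the `i`-th coordinate of `T_ℓ ρ(g)` is `T_ℓ β(g)` of the `m(g)`-combination of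
the coordinates (`ρ(g) ≫ π_i = Σ_j m(g)_{ij} • π_j ≫ β(g)` and functoriality of `T_ℓ`); "the isomorphisms are `G_k`-equivariant".
[cite: MazurRubinSilverberg2007, Thm. 2.2 (iii)] [cite: SerreLinearRepresentations1977, §1.5 (PDF p. 13)] [cite: MumfordAV1970, §19 Thm. 3 (p. 176)] -/
theorem tateModule_coord_asHom_eq_sum (hb : ∑ j, b.π j ≫ b.ι j = 𝟙 b.pt)
    (hρ : ∀ (g : G) (i j : ι), b.ι j ≫ End.asHom (ρ g) ≫ b.π i = m g i j • End.asHom (β g))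
    {e : b.pt.tateModule ℓ ≃ₗ[ℤ_[ℓ]] (ι → Y.tateModule ℓ)} (he : ∀ x i, e x i = tateModuleMap ℓ (b.π i) x) (g : G)
    (x : b.pt.tateModule ℓ) (i : ι) :
    e (tateModuleMap ℓ (End.asHom (ρ g)) x) i = ∑ j, m g i j • tateModuleMap ℓ (End.asHom (β g)) (e x j) := by
  rw [he, ← LinearMap.comp_apply, ← tateModuleMap_comp, asHom_comp_π_eq_sum b m β ρ hb hρ g i, tateModuleMap_sum,
    LinearMap.sum_apply]
  refine Finset.sum_congr rfl fun j _ ↦ ?_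
  rw [tateModuleMap_zsmul, he x j, tateModuleMap_comp]
  rfl

/-- Untwisted case `β = 1`: **`e(T_ℓ ρ(g) x)_i = Σ_j m(g)_{ij} • e(x)_j`** — `T_ℓ(Y ⊗ M) ≅ M ⊗ T_ℓ(Y)` with `G` acting through `M` only
(`T_ℓ(Y ⊗ M) ≅ T_ℓ(Y)^{⊕ rank M}` as `ℤ_ℓ[G]`-modules, `M ⊗ T_ℓ Y`). [cite: MazurRubinSilverberg2007, Thm. 2.2 (iii)] [cite: MumfordAV1970, §19 Thm. 3 (p. 176)] -/
theorem tateModule_coord_asHom_eq_sum_of_one (hb : ∑ j, b.π j ≫ b.ι j = 𝟙 b.pt)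
    (hρ₁ : ∀ (g : G) (i j : ι), b.ι j ≫ End.asHom (ρ g) ≫ b.π i = m g i j • 𝟙 Y)
    {e : b.pt.tateModule ℓ ≃ₗ[ℤ_[ℓ]] (ι → Y.tateModule ℓ)} (he : ∀ x i, e x i = tateModuleMap ℓ (b.π i) x) (g : G)
    (x : b.pt.tateModule ℓ) (i : ι) :
    e (tateModuleMap ℓ (End.asHom (ρ g)) x) i = ∑ j, m g i j • e x j := by
  have h := tateModule_coord_asHom_eq_sum ℓ b m 1 ρ hb (fun g i j ↦ by rw [hρ₁ g i j]; rfl) he g x i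
  simpa only [tateModuleMap_asHom_one_hom ℓ (Y := Y) g, LinearMap.id_apply] using h

end TateCoordinates

end LatticeTensor

end AbelianVariety

end Literature.AlgebraicGeometry.Motives
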